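import Literature.NumberTheory.Sieve.SmoothBVModuli
import HarnessLib

/-!
# Step A (orthogonality) for the smooth weighted prime sums (Hinz 1988, §2 (2.1)–(2.2))

Topic `Literature/NumberTheory/Sieve`, sub-namespace `SmoothStepA`. For a unit class `u mod 𝔮`
put `ψ_Ω(M; 𝔮, u) = ∑_{α ∈ A₀(M), α ≡ u mod 𝔮} Ω(α) Λ((α))` and
`ψ_Ω(M) = ∑_{α ∈ A₀(M)} Ω(α) Λ((α))`. Orthogonality of the characters of `(𝓞_K/𝔮)ˣ` gives
(`psiMod_eq_sum`) `ψ_Ω(M; 𝔮, u) = φ(𝔮)⁻¹ ∑_χ χ(u)⁻¹ S_𝔮(χ)`, the principal character contributes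
the `α` prime to `𝔮`, and so (`stepA`):

`|ψ_Ω(M; 𝔮, u) − ψ_Ω(M)/φ(𝔮)| ≤ φ(𝔮)⁻¹ (∑_{χ ≠ χ₀} |ψ_Ω(χ)| + bad(𝔮))`,

uniformly in `u` — the smooth analogue of the tree's `BoxPrimes.primesAErr_le` (Hinz (2.1)–(2.2):
"`∑ χ₀(ω) = ∑_{ω∈ℜ} 1 + O(log^r y · log N𝔮)` … remains (2.2)").

## References

* J. Hinz, Acta Arith. 51 (1988), §2 (2.1)–(2.2). [cite: Hinz1988, §2 (2.1)–(2.2)]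
* A. C. Cojocaru, M. R. Murty, An introduction to sieve methods, Thm. 9.2.1. [cite: CojocaruMurty2005, Thm. 9.2.1 (PDF p. 98)]
-/

noncomputable section

open Finset NumberField
  Literature.NumberTheory.Sieve.BoxPrimes Literature.NumberTheory.LFunctions
  Literature.NumberTheory.LFunctions.NumberField Literature.NumberTheory.Sieve.TypeTwoReparam
  Literature.NumberTheory.Sieve.TypeTwoBlock Literature.NumberTheory.Sieve.SmoothBVCore
  Literature.NumberTheory.Sieve.SmoothBVModuli Literature.NumberTheory.Sieve.PrimRed
  Literature.NumberTheory.Sieve.MaynardNF Literature.NumberTheory.LFunctions.AbelianDensity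
open scoped Classical

namespace Literature.NumberTheory.Sieve.SmoothStepA

variable {K : Type*} [Field K] [NumberField K]

/-! ## The class sums -/

variable (K) in
/-- `ψ_Ω(M; 𝔮, u) = ∑_{α ∈ A₀(M), α ≡ u mod 𝔮} Ω(α) Λ((α))`. [cite: Hinz1988, §1 (Ψ(ℜ; 𝔮, γ))] -/
def psiMod [IsTotallyReal K] (k : ℝ → ℝ) (M : ℝ) (𝔮 : Ideal (𝓞 K)) (u : 𝓞 K ⧸ 𝔮) : ℂ :=
  ∑ α ∈ (cubeF K M).filter (fun α => Ideal.Quotient.mk 𝔮 α = u), W K k M α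

variable (K) in
/-- `ψ_Ω(M) = ∑_{α ∈ A₀(M)} Ω(α) Λ((α))`. [folklore] -/
def psiAll [IsTotallyReal K] (k : ℝ → ℝ) (M : ℝ) : ℂ := ∑ α ∈ cubeF K M, W K k M α

omit [NumberField K] in
/-- **Weighted orthogonality**: `∑_{α ∈ B, α ≡ u} W(α) = φ⁻¹ ∑_χ χ(u)⁻¹ S_𝔮(χ)`.
[cite: CojocaruMurty2005, Thm. 9.2.1 (PDF p. 98)] -/
theorem sum_filter_mk_eq {𝔮 : Ideal (𝓞 K)} [Finite ((𝓞 K ⧸ 𝔮)ˣ)]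
    (B : Finset (𝓞 K)) (W : 𝓞 K → ℂ) (u : (𝓞 K ⧸ 𝔮)ˣ) :
    ∑ α ∈ B.filter (fun α => Ideal.Quotient.mk 𝔮 α = (u : 𝓞 K ⧸ 𝔮)), W α =
      ((Nat.card ((𝓞 K ⧸ 𝔮)ˣ) : ℂ))⁻¹ * ∑ χ : AddChar (Additive ((𝓞 K ⧸ 𝔮)ˣ)) ℂ,
        (χ (Additive.ofMul u))⁻¹ * charSum B W 𝔮 χ := by
  have hG : (Nat.card ((𝓞 K ⧸ 𝔮)ˣ) : ℂ) ≠ 0 := by exact_mod_cast Nat.card_pos.ne'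
  unfold charSum
  rw [Finset.sum_filter]
  simp_rw [Finset.mul_sum]
  rw [Finset.sum_comm]
  refine Finset.sum_congr rfl fun α _ => ?_
  have hre : ∑ χ : AddChar (Additive ((𝓞 K ⧸ 𝔮)ˣ)) ℂ,
      ((Nat.card ((𝓞 K ⧸ 𝔮)ˣ) : ℂ))⁻¹ * ((χ (Additive.ofMul u))⁻¹ * (W α * unitValue χ (Ideal.Quotient.mk 𝔮 α))) =
      W α * (((Nat.card ((𝓞 K ⧸ 𝔮)ˣ) : ℂ))⁻¹ *
        ∑ χ : AddChar (Additive ((𝓞 K ⧸ 𝔮)ˣ)) ℂ, (χ (Additive.ofMul u))⁻¹ * unitValue χ (Ideal.Quotient.mk 𝔮 α)) := by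
    rw [Finset.mul_sum, Finset.mul_sum]; exact Finset.sum_congr rfl fun χ _ => by ring
  rw [hre]
  by_cases hunit : IsUnit (Ideal.Quotient.mk 𝔮 α)
  · obtain ⟨g, hg⟩ := hunit
    simp only [← hg, unitValue_coe]
    rw [sum_char_inv_mul u g]
    by_cases hgu : g = u
    · subst hgu
      rw [if_pos rfl, if_pos rfl, inv_mul_cancel₀ hG, mul_one]
    · rw [if_neg (fun h => hgu (Units.val_injective h)), if_neg hgu, mul_zero, mul_zero]
  · have hne : ¬ Ideal.Quotient.mk 𝔮 α = (u : 𝓞 K ⧸ 𝔮) := fun h => hunit (h ▸ u.isUnit)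
    rw [if_neg hne]
    simp [unitValue_of_not_isUnit _ hunit]

omit [NumberField K] in
/-- The principal character sums the `α` prime to `𝔮`. [folklore] -/
theorem charSum_zero {𝔮 : Ideal (𝓞 K)} (B : Finset (𝓞 K)) (W : 𝓞 K → ℂ) :
    charSum B W 𝔮 0 = ∑ α ∈ B.filter (fun α => IsUnit (Ideal.Quotient.mk 𝔮 α)), W α := by
  unfold charSum
  rw [Finset.sum_filter]
  refine Finset.sum_congr rfl fun α _ => ?_
  by_cases h : IsUnit (Ideal.Quotient.mk 𝔮 α)
  · rw [if_pos h, unitValue_zero_of_isUnit h, mul_one]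
  · rw [if_neg h, unitValue_of_not_isUnit _ h, mul_zero]

omit [NumberField K] in
/-- The coprime part differs from the full sum by at most `bad(𝔮)`. [cite: Hinz1988, §2 (2.1)] -/
theorem norm_charSum_zero_sub_le {𝔮 : Ideal (𝓞 K)} (B : Finset (𝓞 K)) (W : 𝓞 K → ℂ) :
    ‖charSum B W 𝔮 0 - ∑ α ∈ B, W α‖ ≤ badSum B W 𝔮 := by
  rw [charSum_zero, badSum, ← Finset.sum_filter_add_sum_filter_not B (fun α => IsUnit (Ideal.Quotient.mk 𝔮 α)) W,
    sub_add_cancel_left, norm_neg]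
  exact norm_sum_le _ _

/-- **Step A for the smooth sums**: for `𝔮 ≠ 0` and a unit class `u`,
`|ψ_Ω(M; 𝔮, u) − ψ_Ω(M)/φ(𝔮)| ≤ φ(𝔮)⁻¹ (∑_{χ≠χ₀} |ψ_Ω(χ)| + bad(𝔮))`. [cite: Hinz1988, §2 (2.1)–(2.2)] -/
theorem stepA [IsTotallyReal K] (k : ℝ → ℝ) (M : ℝ) {𝔮 : Ideal (𝓞 K)} (h𝔮 : 𝔮 ≠ ⊥) (u : (𝓞 K ⧸ 𝔮)ˣ) :
    ‖psiMod K k M 𝔮 (u : 𝓞 K ⧸ 𝔮) - ((idealTotient K 𝔮 : ℝ) : ℂ)⁻¹ * psiAll K k M‖ ≤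
      (idealTotient K 𝔮)⁻¹ * (∑ χ ∈ nonprincipalChars K 𝔮, ‖psiΩ K χ k M‖ + badSum (cubeF K M) (W K k M) 𝔮) := by
  haveI : Finite (𝓞 K ⧸ 𝔮) := Ideal.finiteQuotientOfFreeOfNeBot 𝔮 h𝔮
  letI : Fintype (𝓞 K ⧸ 𝔮) := Fintype.ofFinite _
  have hφ := idealTotient_pos (K := K) h𝔮
  have hφeq : idealTotient K 𝔮 = Nat.card ((𝓞 K ⧸ 𝔮)ˣ) := idealTotient_eq_natCard_units h𝔮
  have hcard : (0 : ℝ) < Nat.card ((𝓞 K ⧸ 𝔮)ˣ) := by exact_mod_cast Nat.card_pos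
  have hφC : ((idealTotient K 𝔮 : ℝ) : ℂ) = (Nat.card ((𝓞 K ⧸ 𝔮)ˣ) : ℂ) := by rw [hφeq]; push_cast; rfl
  -- orthogonality and the split off of `χ₀`
  have horth := sum_filter_mk_eq (𝔮 := 𝔮) (cubeF K M) (W K k M) u
  have hnp : nonprincipalChars K 𝔮 = (Finset.univ : Finset (AddChar (Additive ((𝓞 K ⧸ 𝔮)ˣ)) ℂ)).erase 0 := by
    rw [nonprincipalChars, dif_neg h𝔮]
  unfold psiMod psiAll
  rw [horth, hφC, ← Finset.add_sum_erase _ _ (Finset.mem_univ (0 : AddChar (Additive ((𝓞 K ⧸ 𝔮)ˣ)) ℂ)),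
    AddChar.zero_apply, inv_one, one_mul, mul_add, ← hnp]
  -- `‖φ⁻¹ S(χ₀) + φ⁻¹ ∑_{χ≠χ₀} − φ⁻¹ ∑_all‖ ≤ φ⁻¹ (bad + ∑_{χ≠χ₀} |S(χ)|)`
  have hinvC : ‖((Nat.card ((𝓞 K ⧸ 𝔮)ˣ) : ℂ))⁻¹‖ = (idealTotient K 𝔮)⁻¹ := by
    rw [norm_inv, Complex.norm_natCast, hφeq]
  calc ‖((Nat.card ((𝓞 K ⧸ 𝔮)ˣ) : ℂ))⁻¹ * charSum (cubeF K M) (W K k M) 𝔮 0 +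
        ((Nat.card ((𝓞 K ⧸ 𝔮)ˣ) : ℂ))⁻¹ * ∑ χ ∈ nonprincipalChars K 𝔮, (χ (Additive.ofMul u))⁻¹ * charSum (cubeF K M) (W K k M) 𝔮 χ -
        ((Nat.card ((𝓞 K ⧸ 𝔮)ˣ) : ℂ))⁻¹ * ∑ α ∈ cubeF K M, W K k M α‖
      = ‖((Nat.card ((𝓞 K ⧸ 𝔮)ˣ) : ℂ))⁻¹ * ((charSum (cubeF K M) (W K k M) 𝔮 0 - ∑ α ∈ cubeF K M, W K k M α) +
          ∑ χ ∈ nonprincipalChars K 𝔮, (χ (Additive.ofMul u))⁻¹ * charSum (cubeF K M) (W K k M) 𝔮 χ)‖ := by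
        congr 1; ring
    _ ≤ (idealTotient K 𝔮)⁻¹ * (badSum (cubeF K M) (W K k M) 𝔮 + ∑ χ ∈ nonprincipalChars K 𝔮, ‖psiΩ K χ k M‖) := by
        rw [norm_mul, hinvC]
        refine mul_le_mul_of_nonneg_left ((norm_add_le _ _).trans (add_le_add (norm_charSum_zero_sub_le _ _) ?_))
          (inv_nonneg.2 hφ.le)
        refine (norm_sum_le _ _).trans (Finset.sum_le_sum fun χ _ => ?_)
        rw [norm_mul, norm_inv, AddChar.norm_apply, inv_one, one_mul, psiΩ_eq_charSum]
    _ = _ := by rw [add_comm (badSum _ _ _)]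

end Literature.NumberTheory.Sieve.SmoothStepA
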